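import Summits.QuantumAdvantage.QuantumAdvantage.Theorems.CubicForrelationNearExactIsExactTwelveZ512Div8Dead
import Summits.QuantumAdvantage.QuantumAdvantage.Theorems.CubicForrelationNearExactIsExactTwelveLevelSixBothAt2932
import Summits.QuantumAdvantage.QuantumAdvantage.Theorems.CubicForrelationNearExactIsExactTwelveLevelSixEightPrep768

/-!
# Crux `CubicForrelation.NearExactIsExact` (stmt-QuantumAdvantage-14043) — n = 12, the OPEN window `57/64 < Φ < 29/32`, both sides at
  level `≥ 6`, configuration `#Z = 512`: small on-flat excess (`Σ_Z (e² − 1) ≤ 136`) with off-flat energy `≤ 255` is DEAD on the whole window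

Certificate seat `b2b-cforr-cert` (gen 26).  HONEST FRAMING: a kernel-checked finite-slice lemma (standard axioms) about cubic Boolean pairs on 12
bits; it closes a sub-configuration of the level-`≥ 6` × level-`≥ 6` branch below `29/32` and claims NO new value of `θ₁₂`.  NOT summit progress.

Setting: cubic `f, g`, `W_g = 64u''`, `W_f = 64wf`, `Z = {u'' even} = x_Z ⊕ V₀` a 9-flat, `e = u'' − (−1)^f`, `57/64 < Φ < 1` (so
`Σ e² ≤ 895`); write `D := Σ_Z (e² − 1)` (on-flat excess) and `E_off := Σ_{Z^c} e²` (`D + E_off = Σ e² − 512 ≤ 383`).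

THEOREM `tzx_Z512_smallD_false`: `E_off ≤ 255` and `D ≤ 136` is impossible.  Proof: gen 20's off-flat trichotomy (`tw20_off_flat_lt256` at
`E = 255`).  (i) Main branch `8 ∣ e` off `Z`: the points of `L = {x ∈ Z : (e − σ)/4 odd}` have `|e| ≥ 3`, cost `≥ 8`, so `#L ≤ 17 ≤ 31`;
gen 23's `tw23_levelSix_eight_prep768` makes `λ` even on `Z` (`e ≡ ±1 (mod 8)`), and gen 26's `tzf_Z512_div8_false` kills it.  (ii) Sparse
two-coset exception: (H3)/(H4) by avoidance (`tw15_H34_avoid`), `e² ∈ {1, 49, 81}` on `Z` (`tw20_onZ_mod8_values`, needs `D ≤ 136`; `225` is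
over budget), then gen 18's dual kill `tw18_levelSix_sparse9_false 255 136` (`3·255 + 4·136 = 1309 < 1440`).  (iii) Rigid exception: (H3)/(H4)
by weighted few-hit transversals (`tw20_H34_rigid_wt`, weight budget `63` from `4a + 12b ≤ 255`), then the same two steps.
Since `D + E_off ≥ 260` on the window, the lemma says: a 9-flat side has `D ≥ 137` (at least two points of `Z` with `|e| ≥ 7`, or `L ≠ ∅`, …)
or `E_off ≥ 256`.  Combined with `tzf_levelSix_window_residual2` (…TwelveZ512WindowResidual): see HOME/b2b-cforr-cert-g26/PROOF-N12-WINDOW-L6.md §3.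

References: MacWilliams–Sloane (1977) Ch. 13–15; R. O'Donnell (2014) §3.3.  Axioms: the standard three.
-/

set_option linter.dupNamespace false -- D-0017: single-problem summit ⇒ `QuantumAdvantage.QuantumAdvantage` by design

noncomputable section

namespace Summit.QuantumAdvantage.QuantumAdvantage.Theorems.CubicForrelation.NearExactIsExact

open Finset
open Literature.Computability.QuantumComplexity
open Literature.Computability.QuantumComplexity.BuzetChailloux (bxor zeroVec bxor_bxor_cancel_left bxor_zeroVec zeroVec_bxor bxor_comm
  bxor_self)
open Literature.Computability.QuantumComplexity.DerivativeWalsh (W)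

/-- **Small on-flat excess with off-flat energy `≤ 255` is dead on the window** (both sides at level `≥ 6`, `#Z = 512`; module docstring).
Finite-slice statement, NOT summit progress. [this work] -/
theorem tzx_Z512_smallD_false (f g : (Fin (6 + 6) → Bool) → Bool) (hf : IsDegLeFun 3 f) (hg : IsDegLeFun 3 g)
    (u'' : (Fin (6 + 6) → Bool) → ℤ) (hu'' : ∀ x, W (fun y => signOf (g y)) x = (2 : ℝ) ^ 6 * (u'' x : ℝ))
    (wf : (Fin (6 + 6) → Bool) → ℤ) (hwf : ∀ y, W (fun x => signOf (f x)) y = (2 : ℝ) ^ 6 * (wf y : ℝ))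
    (V₀ : Finset (Fin (6 + 6) → Bool)) (xZ : Fin (6 + 6) → Bool) (h0 : zeroVec ∈ V₀)
    (hadd : ∀ a ∈ V₀, ∀ b ∈ V₀, bxor a b ∈ V₀) (hcardV : #V₀ = 512)
    (hS : (univ.filter fun x : Fin (6 + 6) → Bool => ¬ Odd (u'' x)) = V₀.image (bxor xZ))
    (hDZ : ∑ x ∈ (univ.filter fun x : Fin (6 + 6) → Bool => ¬ Odd (u'' x)), ((u'' x - sZ (f x)) ^ 2 - 1) ≤ 136)
    (hoff_le : ∑ x ∈ univ.filter (fun x => x ∉ univ.filter (fun x : Fin (6 + 6) → Bool => ¬ Odd (u'' x))),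
      (u'' x - sZ (f x)) ^ 2 ≤ 255)
    (hlo : (57 / 64 : ℝ) < forrelation f g) (hhi : forrelation f g < 1) : False := by
  classical
  set Z := univ.filter (fun x : Fin (6 + 6) → Bool => ¬ Odd (u'' x)) with hZdef
  have hmemZ : ∀ x, x ∈ Z ↔ ¬ Odd (u'' x) := fun x => by simp [hZdef]
  set e : (Fin (6 + 6) → Bool) → ℤ := fun x => u'' x - sZ (f x) with hedef
  have hcardV9 : #V₀ = 2 ^ 9 := by rw [hcardV]; norm_num
  have hlo78 : (7 / 8 : ℝ) < forrelation f g := by linarith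
  have heodd : ∀ x, x ∈ Z → Odd (e x) := by
    intro x hx
    have hev := Int.not_odd_iff_even.1 ((hmemZ x).1 hx)
    rcases tp_sZ_cases (f x) with hs | hs <;> simp only [e] <;> rw [hs]
    · exact Int.odd_sub.2 (iff_of_false (Int.not_odd_iff_even.2 hev) (by decide))
    · exact Int.odd_sub.2 (iff_of_false (Int.not_odd_iff_even.2 hev) (by decide))
  have hsq1 : ∀ x, x ∈ Z → 1 ≤ e x ^ 2 := by
    intro x hx
    have h0' := Int.odd_iff.1 (heodd x hx)
    have : e x ≤ -1 ∨ 1 ≤ e x := by omega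
    have := tp_sq_ge (k := 1) (by norm_num) this
    linarith
  -- values on `Z` once (H3)/(H4) are available
  have hZ1_of : (∀ x ∈ Z, ∀ a b c : Fin (6 + 6) → Bool, a ∈ V₀ → b ∈ V₀ → c ∈ V₀ →
        (4 : ℤ) ∣ ∑ ε : Fin 3 → Bool, e (fun j => x j ^^ decide (Odd #(univ.filter fun i =>
          ε i && (![a, b, c] : Fin 3 → Fin (6 + 6) → Bool) i j)))) →
      (∀ x ∈ Z, ∀ a₀ a₁ a₂ a₃ : Fin (6 + 6) → Bool, a₀ ∈ V₀ → a₁ ∈ V₀ → a₂ ∈ V₀ → a₃ ∈ V₀ →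
        (8 : ℤ) ∣ ∑ ε : Fin 4 → Bool, e (fun j => x j ^^ decide (Odd #(univ.filter fun i =>
          ε i && (![a₀, a₁, a₂, a₃] : Fin 4 → Fin (6 + 6) → Bool) i j)))) →
      ∀ x ∈ Z, e x ^ 2 = 1 ∨ e x ^ 2 = 49 ∨ e x ^ 2 = 81 := by
    intro H3 H4 x hx
    have hvals := tw20_onZ_mod8_values f u'' V₀ xZ h0 hadd hcardV hS hDZ H3 H4
    rcases hvals x hx with h1 | h49 | h81 | h225
    · exact Or.inl h1
    · exact Or.inr (Or.inl h49)
    · exact Or.inr (Or.inr h81)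
    · exfalso
      have h2 : e x ^ 2 - 1 ≤ ∑ y ∈ Z, (e y ^ 2 - 1) :=
        single_le_sum (f := fun y => e y ^ 2 - 1) (fun y hy => by linarith [hsq1 y hy]) hx
      change 225 ≤ e x ^ 2 at h225
      linarith
  rcases tw20_off_flat_lt256 255 (by norm_num) f g hf hg u'' hu'' V₀ xZ h0 hadd hcardV9 hS hoff_le with
      h8 | ⟨y₁, y₂, hy₁, hy₂, hy₁₂, hoff, hc₁, hc₂, -⟩ | ⟨y₁, y₂, y₃, hy₁, hy₂, hy₃, hy₁₂, hy₁₃, hy₂₃, hΩC, hΩwt, -⟩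
  · /- main branch: `#L ≤ 17`, so `λ` is even on `Z` (prep768) and gen 26's `tzf_Z512_div8_false` applies -/
    set L := Z.filter (fun x => Odd ((e x - sZ (decide (e x % 4 = 3))) / 4)) with hLdef
    have hcostL : ∀ x ∈ L, (9 : ℤ) ≤ e x ^ 2 := by
      intro x hx
      have hx' := mem_filter.1 hx
      have ho := Int.odd_iff.1 (heodd x hx'.1)
      have hlam := Int.odd_iff.1 hx'.2
      have h3 : e x ≤ -3 ∨ 3 ≤ e x := by
        by_cases hm : e x % 4 = 3
        · have hs : sZ (decide (e x % 4 = 3)) = -1 := by rw [decide_eq_true hm]; simp [sZ]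
          rw [hs] at hlam; omega
        · have hs : sZ (decide (e x % 4 = 3)) = 1 := by rw [decide_eq_false hm]; simp [sZ]
          rw [hs] at hlam; omega
      have := tp_sq_ge (k := 3) (by norm_num) h3
      linarith
    have hL31 : #L ≤ 31 := by
      have h1 : (8 : ℤ) * #L ≤ ∑ x ∈ L, (e x ^ 2 - 1) := by
        have := sum_le_sum fun x hx => (show (8 : ℤ) ≤ e x ^ 2 - 1 by linarith [hcostL x hx])
        rw [sum_const, nsmul_eq_mul] at this
        linarith
      have h2 : ∑ x ∈ L, (e x ^ 2 - 1) ≤ ∑ x ∈ Z, (e x ^ 2 - 1) :=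
        sum_le_sum_of_subset_of_nonneg (filter_subset _ _) fun x hx _ => by linarith [hsq1 x hx]
      have : (8 : ℤ) * #L ≤ 136 := by linarith
      have : (#L : ℤ) ≤ 17 := by linarith
      have : #L ≤ 17 := by exact_mod_cast this
      omega
    obtain ⟨hLeven, -⟩ := tw23_levelSix_eight_prep768 (∑ x, (u'' x - sZ (f x)) ^ 2 : ℤ) f g hf hg u'' hu'' le_rfl
      V₀ xZ h0 hadd hcardV hS h8 hL31
    refine tzf_Z512_div8_false f g hf hg u'' hu'' wf hwf V₀ xZ h0 hadd hcardV hS h8 (fun x hx => ?_) hlo hhi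
    obtain ⟨k, hk⟩ := hLeven x hx
    have ho := Int.odd_iff.1 (heodd x hx)
    change e x % 2 = 1 at ho
    change (e x - sZ (decide (e x % 4 = 3))) / 4 = k + k at hk
    show (8 : ℤ) ∣ e x - 1 ∨ (8 : ℤ) ∣ e x + 1
    by_cases h3 : e x % 4 = 3
    · have hs : sZ (decide (e x % 4 = 3)) = -1 := by rw [decide_eq_true h3]; simp [sZ]
      rw [hs] at hk
      right; exact ⟨k, by omega⟩
    · have hs : sZ (decide (e x % 4 = 3)) = 1 := by rw [decide_eq_false h3]; simp [sZ]
      rw [hs] at hk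
      left; exact ⟨k, by omega⟩
  · /- sparse two-coset exception -/
    obtain ⟨H3, H4⟩ := tw15_H34_avoid f g hf hg u'' hu'' V₀ xZ h0 hadd hcardV hS y₁ y₂ hy₁ hy₂ hy₁₂ hoff hc₁ hc₂
    have hZ1 := hZ1_of H3 H4
    exact tw18_levelSix_sparse9_false 255 136 (by norm_num) f g hf hg u'' hu'' wf hwf hlo78 hhi
      V₀ xZ h0 hadd hcardV hS hZ1 hDZ hoff_le H3 H4
  · /- rigid exception -/
    have hwt63 : #(univ.filter fun ω => ω ∉ Z ∧ ¬ (8 : ℤ) ∣ e ω) +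
        #((univ.filter fun ω => ω ∉ Z ∧ ¬ (8 : ℤ) ∣ e ω).filter fun y => e y ^ 2 ≠ 4) ≤ 63 := by
      change 4 * (#(univ.filter fun ω => ω ∉ Z ∧ ¬ (8 : ℤ) ∣ e ω) : ℤ) +
        12 * #((univ.filter fun ω => ω ∉ Z ∧ ¬ (8 : ℤ) ∣ e ω).filter fun ω => e ω ^ 2 ≠ 4) ≤ 255 at hΩwt
      omega
    obtain ⟨H3, H4⟩ := tw20_H34_rigid_wt f g hf hg u'' hu'' V₀ xZ h0 hadd hcardV hS
      (univ.filter fun ω => ω ∉ Z ∧ ¬ (8 : ℤ) ∣ e ω) y₁ y₂ y₃ hy₁ hy₂ hy₃ hy₁₂ hy₁₃ hy₂₃ hΩC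
      (fun y hy h8 => mem_filter.2 ⟨mem_univ _, hy, h8⟩) hwt63
    have hZ1 := hZ1_of H3 H4
    exact tw18_levelSix_sparse9_false 255 136 (by norm_num) f g hf hg u'' hu'' wf hwf hlo78 hhi
      V₀ xZ h0 hadd hcardV hS hZ1 hDZ hoff_le H3 H4

end Summit.QuantumAdvantage.QuantumAdvantage.Theorems.CubicForrelation.NearExactIsExact

end
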